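import Summits.BirchSwinnertonDyer.BirchSwinnertonDyer.Theorems.KimAtThreeStubOfLiftableAssembly
import Summits.BirchSwinnertonDyer.BirchSwinnertonDyer.Theorems.KimAtThreeStubCoreVertex
import Summits.BirchSwinnertonDyer.Rank1Residual.GaloisImage.SakamotoN11InstanceDeepTower
import HarnessLib

/-!
# Route `KimAtThreeKolyvagin` (rung W2), crux `StubAtEmptyLevelThree` (item 19561): the stub at `∅`
# GRANTED the S24-DEEP port — inputs (L-a) and (L-c) of the liftability road discharged

Cell `bsd-addord`, seat `bsd-addord-w2-c2` (gen 3). TOOL FILE: theorems only, no definition, no named fact, no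
`sorry`; closes nothing; books nothing. HONEST FRAMING: BSD is not proved by any of this; item 19561 stays
OPEN; the theorem below is CONDITIONAL on the typed missing input
`GaloisImage.S24Deep.kolyvaginSystems_freeRankOne_zmod_three_pow_deep` (S24-DEEP (1): Sakamoto's
Thm. 4.4 (1) for the DEEP Chebotarev sub-class; flag S24-DEEP-PORT@3, an EXISTING debt line of the route)
and on four more displayed inputs that are outputs of the tree's constructors / [S24] Thm. 4.4 (2).

## What

* `apply_eq_zero_of_free_of_fullOrder` — RIGIDITY from FREENESS: if `KS₁` is free of rank one over
  `ℤ/3^{k+1}` and SOME Kolyvagin system has a coordinate `g_{d₀}` of full order `3^{k+1}`, then every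
  Kolyvagin system vanishing at `d₀` vanishes (pure algebra: `s = c·h`, `g = b·h` for the generator `h`,
  `ord(h_{d₀}) = 3^{k+1}`, `c·h_{d₀} = 0 ⟹ 3^{k+1} ∣ c ⟹ s = 0`). This is input (L-a) of
  `KimAtThreeStubLiftability` at a core vertex.
* `stubShape_of_s24Deep` — THE 19561 CONCLUSION `g ∅ = 3^{n₀}•e + m′` for tower rows and data of the
  TowerPackage / deep-family shape (levels `k ≤ k̃`, pinned datum `D_k`, deep datum `D̃` with primes = the
  class of `τ` at level `3^{k̃+1}` through `E[3^{k̃}·3]`, `D̃.primes ⊆ D_k.primes`, cyclotomic transverse,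
  canonical comparison for one `η`; generators `g`, `g̃` with `g̃` of order `3^{k̃+1}`), GRANTED:
  the S24-DEEP (1) port `hS24d` (freeness of `KS₁(E[3^{k+1}], 𝓕_can, 𝒫̃)`, through n1011-p04's instance
  `kolyvaginSystems_freeRankOne_propagatedSelmerStructure_deep_of_towerSurj`); [S24] Thm. 4.4 (2) in ORDER
  form and the Poitou–Tate pair counts at both depths (`hR22`, `hR22'`, `hPT`, `hPT'` — TowerPackage /
  `DeepLedger` outputs); the three counts (iii) at the lift level; the order (iv) of `g ∅`. The core vertex
  `d₀` and the unit `w` are PRODUCED (`exists_coreVertex_map_red_eq_smul`), rigidity at `d₀` comes from the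
  port's freeness (`apply_eq_zero_of_free_of_fullOrder`), and the rest is `stubShape_of_coreVertex_inputs`.

NET for item 19561 (= binder `hStub` of the §U glue): on the Kato-stratum data the road instantiates,
the stub at the empty level follows from {S24-DEEP (1) port, [S24] 4.4 (1)(2) PUB, Poitou–Tate PUB + the
local index datum at `3` behind the pair counts, the three counts (iii)} — Mazur–Rubin's Thm. 4.4.3 road,
kernel-checked end to end except these named inputs.

References: [MazurRubin2004] Lemma 4.1.1, Thm. 4.1.13, Thm. 4.4.1, Thm. 4.4.3; [Sakamoto2024] Thm. 4.4 (1)(2),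
Lemma 5.2, Cor. 5.5; [Rubin2011] Thm. 2.8.4, Cor. 2.8.9.
-/

-- the Theorems namespace of a single-conjunct summit repeats the summit name by design (D-0017)
set_option linter.dupNamespace false

noncomputable section

open scoped Classical NumberField ContRepresentation
open Function Field NumberField IsDedekindDomain WeierstrassCurve Literature.NumberTheory.EllipticCurves
  Literature.NumberTheory.GaloisRepresentations Literature.NumberTheory.GaloisRepresentations.DiscreteGaloisModule
  Literature.NumberTheory.GaloisCohomology Literature.NumberTheory.GaloisCohomology.KolyvaginDatum
  Summit.BirchSwinnertonDyer.Rank1Residual.GaloisImage Summit.BirchSwinnertonDyer.Rank1Residual.GaloisImage.Transport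

namespace Summit.BirchSwinnertonDyer.BirchSwinnertonDyer.Theorems.KimAtThreeStubOfLiftable

/-- **Rigidity from freeness** (input (L-a) at a core vertex): if `KS₁(T, 𝓕, 𝒫)` is free of rank one
over `ℤ/3^{k+1}` (`IsFreeRankOneZMod`), every class is killed by `3^{k+1}`, and some Kolyvagin system `g`
has `ord(g_{d₀}) = 3^{k+1}`, then a Kolyvagin system vanishing at `d₀` vanishes identically.
[cite: MazurRubin2004, Thm. 4.4.1 (p. 45) and Cor. 4.5.2] [cite: Sakamoto2024, Thm. 4.4 (1) (p. 926)] -/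
theorem apply_eq_zero_of_free_of_fullOrder {W : WeierstrassCurve ℚ} {k : ℕ}
    {D : KolyvaginDatum (W.torsionGaloisModule (((3 : ℕ) : ℤ) ^ k * ((3 : ℕ) : ℤ)))}
    {𝓕 : SelmerStructure (W.torsionGaloisModule (((3 : ℕ) : ℤ) ^ k * ((3 : ℕ) : ℤ)))}
    (hfree : KolyvaginSystem.IsFreeRankOneZMod (D.kolyvaginSystems 𝓕) (3 ^ (k + 1)))
    {g : Finset (HeightOneSpectrum (𝓞 ℚ)) →
      galoisCohomology (W.torsionGaloisModule (((3 : ℕ) : ℤ) ^ k * ((3 : ℕ) : ℤ))) 1}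
    (hg : g ∈ D.kolyvaginSystems 𝓕) {d₀ : Finset (HeightOneSpectrum (𝓞 ℚ))}
    (hgo : addOrderOf (g d₀) = 3 ^ (k + 1))
    {s : Finset (HeightOneSpectrum (𝓞 ℚ)) →
      galoisCohomology (W.torsionGaloisModule (((3 : ℕ) : ℤ) ^ k * ((3 : ℕ) : ℤ))) 1}
    (hs : s ∈ D.kolyvaginSystems 𝓕) (hs0 : s d₀ = 0) : s = 0 := by
  haveI : NeZero (3 ^ (k + 1)) := ⟨pow_ne_zero _ three_ne_zero⟩
  obtain ⟨κ, -, hκo, hgen⟩ := exists_basis_of_isFreeRankOneZMod _ hfree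
  obtain ⟨b, hb⟩ := hgen g hg
  obtain ⟨c, hc⟩ := hgen s hs
  -- the generator's coordinate at `d₀` has full order
  have hkill : ∀ x : galoisCohomology (W.torsionGaloisModule (((3 : ℕ) : ℤ) ^ k * ((3 : ℕ) : ℤ))) 1,
      3 ^ (k + 1) • x = 0 := pow_succ_nsmul_galoisCohomology W k
  have hκd : addOrderOf (κ.1 d₀) = 3 ^ (k + 1) := by
    refine Nat.dvd_antisymm (addOrderOf_dvd_of_nsmul_eq_zero (hkill _)) ?_
    rw [← hgo, hb, Pi.smul_apply]
    exact addOrderOf_smul_dvd _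
  -- `c • κ d₀ = 0` forces `3^{k+1} ∣ c`
  have hdvd : 3 ^ (k + 1) ∣ c := by
    rw [← hκd]
    apply addOrderOf_dvd_of_nsmul_eq_zero
    have h := hs0
    rwa [hc, Pi.smul_apply] at h
  obtain ⟨c', rfl⟩ := hdvd
  rw [hc]
  funext d
  simp only [Pi.smul_apply, Pi.zero_apply]
  rw [mul_nsmul', hkill]

/-- **Item 19561's conclusion GRANTED the S24-DEEP (1) port** (module docstring): for a tower row, levels
`k ≤ k̃`, the reduction `red` (`x ↦ 3^{k̃−k}x`), a pinned datum `D_k` and a DEEP datum `D̃` (primes = the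
class of `τ` at `3^{k̃+1}` through `E[3^{k̃}·3]`, contained in `D_k.primes`, outside `S ⊇ ∞ ∪ {3} ∪ {bad}`),
cyclotomic transverse conditions, canonical comparison maps for one `η`, generators `g`, `g̃` ([S24] (1)
outputs; `g̃` of order `3^{k̃+1}`) with [S24] (2) in ORDER form and the pair counts at both depths, the three
counts (iii) and the order (iv): `g ∅ = 3^{n₀}•e + m′`, `e ∈ H¹_{𝓕_can}(ℚ, E[3^{k+1}])`, `m′ ∈ H¹_𝓚`.
[cite: MazurRubin2004, Thm. 4.4.3 (pp. 46–47)] [cite: Sakamoto2024, Thm. 4.4 (1)(2) (p. 926)] -/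
theorem stubShape_of_s24Deep
    (hS24d : S24Deep.kolyvaginSystems_freeRankOne_zmod_three_pow_deep)
    (W : WeierstrassCurve ℚ) [W.IsElliptic] [Finite (geomTorsion W ((3 : ℕ) : ℤ))]
    (htower : ∀ n : ℕ, W.HasSurjectiveModNGaloisRep (3 ^ n : ℕ)) {k kt : ℕ} (hkk : k ≤ kt) {n₀ : ℕ}
    [Finite (geomTorsion W (((3 : ℕ) : ℤ) ^ k * ((3 : ℕ) : ℤ)))]
    [Finite (geomTorsion W (((3 : ℕ) : ℤ) ^ kt * ((3 : ℕ) : ℤ)))]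
    (red : (W.torsionGaloisModule (((3 : ℕ) : ℤ) ^ kt * ((3 : ℕ) : ℤ))).toContRepresentation →ⁱL
      (W.torsionGaloisModule (((3 : ℕ) : ℤ) ^ k * ((3 : ℕ) : ℤ))).toContRepresentation)
    (hred : ∀ x : geomTorsion W (((3 : ℕ) : ℤ) ^ kt * ((3 : ℕ) : ℤ)),
      ((red x : geomTorsion W (((3 : ℕ) : ℤ) ^ k * ((3 : ℕ) : ℤ))) : geomPoints W) =
        (((3 : ℕ) : ℤ) ^ (kt - k)) • (x : geomPoints W))
    -- the deepest `τ` and the Poitou–Tate family at `3` (inputs of the deep S24 instance)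
    (τ : absoluteGaloisGroup ℚ) (hτμ : τ ∈ rootsOfUnityFixer ℚ (3 ^ (kt + 1)))
    (hτq : Nonempty (cokerSubOne (W.torsionGaloisModule (((3 : ℕ) : ℤ) ^ kt * ((3 : ℕ) : ℤ))) τ ≃+
      ZMod (3 ^ (kt + 1))))
    (inv₃ : LocalInvariants ℚ 3) (hperf₃ : inv₃.IsPerfect) (hsum₃ : inv₃.SumLocalTermEqZero)
    (hcompl₃ : inv₃.SelmerComplement)
    (hEP : ∀ v : HeightOneSpectrum (𝓞 ℚ), localEulerPoincareCharacteristic (v.adicCompletion ℚ))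
    {S : Finset (Place ℚ)} (hS : ∀ w : InfinitePlace ℚ, (Sum.inl w : Place ℚ) ∈ S)
    (h3S : ∀ v : HeightOneSpectrum (𝓞 ℚ), ((3 : ℕ) : 𝓞 ℚ) ∈ v.asIdeal → (Sum.inr v : Place ℚ) ∈ S)
    (hbadS : ∀ v : HeightOneSpectrum (𝓞 ℚ), ¬ W.HasGoodReductionAt v → (Sum.inr v : Place ℚ) ∈ S)
    -- the data at the two levels
    {Dk : KolyvaginDatum (W.torsionGaloisModule (((3 : ℕ) : ℤ) ^ k * ((3 : ℕ) : ℤ)))}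
    {Dt : KolyvaginDatum (W.torsionGaloisModule (((3 : ℕ) : ℤ) ^ kt * ((3 : ℕ) : ℤ)))}
    (hPP : Dt.primes ⊆ Dk.primes)
    (hPt : Dt.primes = frobeniusClassPrimes
      (W.torsionGaloisModule (((3 : ℕ) : ℤ) ^ kt * ((3 : ℕ) : ℤ))) {v | (Sum.inr v : Place ℚ) ∈ S} τ (3 ^ (kt + 1)))
    (hTk : Dk.transverse = cyclotomicTransverse _) (hTt : Dt.transverse = cyclotomicTransverse _)
    {η : (q : HeightOneSpectrum (𝓞 ℚ)) → (ZMod (Ideal.absNorm q.asIdeal))ˣ}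
    (hDk : Dk.HasCanonicalComparison (3 ^ (k + 1)) η) (hDt : Dt.HasCanonicalComparison (3 ^ (kt + 1)) η)
    -- the generators at the two levels ([S24] Thm. 4.4 (1) outputs)
    {g : Finset (HeightOneSpectrum (𝓞 ℚ)) →
      galoisCohomology (W.torsionGaloisModule (((3 : ℕ) : ℤ) ^ k * ((3 : ℕ) : ℤ))) 1}
    (hg : g ∈ Dk.kolyvaginSystems (propagatedSelmerStructure W 3 k))
    {gt : Finset (HeightOneSpectrum (𝓞 ℚ)) →
      galoisCohomology (W.torsionGaloisModule (((3 : ℕ) : ℤ) ^ kt * ((3 : ℕ) : ℤ))) 1}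
    (hgt : gt ∈ Dt.kolyvaginSystems (propagatedSelmerStructure W 3 kt))
    (hgto : addOrderOf gt = 3 ^ (kt + 1))
    -- [S24] Thm. 4.4 (2) in ORDER form and the pair counts, both depths (full-level PT families)
    (inv : LocalInvariants ℚ (3 ^ (k + 1))) (inv' : LocalInvariants ℚ (3 ^ (kt + 1)))
    (hR22 : ∀ d, Dk.IsLevel d →
      (Nat.card (inv.dualSelmerStructure _ (Dk.atLevel (propagatedSelmerStructure W 3 k) d)).selmerGroup
          ∣ 3 ^ (k + 1) →
        addOrderOf (g d) * Nat.card (inv.dualSelmerStructure _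
          (Dk.atLevel (propagatedSelmerStructure W 3 k) d)).selmerGroup = 3 ^ (k + 1)) ∧
      (3 ^ (k + 1) ∣ Nat.card (inv.dualSelmerStructure _
          (Dk.atLevel (propagatedSelmerStructure W 3 k) d)).selmerGroup → g d = 0))
    (hR22' : ∀ d, Dt.IsLevel d →
      (Nat.card (inv'.dualSelmerStructure _ (Dt.atLevel (propagatedSelmerStructure W 3 kt) d)).selmerGroup
          ∣ 3 ^ (kt + 1) →
        addOrderOf (gt d) * Nat.card (inv'.dualSelmerStructure _
          (Dt.atLevel (propagatedSelmerStructure W 3 kt) d)).selmerGroup = 3 ^ (kt + 1)) ∧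
      (3 ^ (kt + 1) ∣ Nat.card (inv'.dualSelmerStructure _
          (Dt.atLevel (propagatedSelmerStructure W 3 kt) d)).selmerGroup → gt d = 0))
    (hPT : ∀ d, Dk.IsLevel d →
      Nat.card (Dk.atLevel (propagatedSelmerStructure W 3 k) d).selmerGroup =
        3 ^ (k + 1) * Nat.card (inv.dualSelmerStructure _
          (Dk.atLevel (propagatedSelmerStructure W 3 k) d)).selmerGroup)
    (hPT' : ∀ d, Dt.IsLevel d →
      Nat.card (Dt.atLevel (propagatedSelmerStructure W 3 kt) d).selmerGroup =
        3 ^ (kt + 1) * Nat.card (inv'.dualSelmerStructure _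
          (Dt.atLevel (propagatedSelmerStructure W 3 kt) d)).selmerGroup)
    -- (iii) the three counts on `S̃ = H¹_{𝓕_can}(ℚ, E[3^{k̃+1}])`
    [Finite (propagatedSelmerStructure W 3 kt).selmerGroup]
    (hcard : Nat.card (propagatedSelmerStructure W 3 kt).selmerGroup = 3 ^ (kt + 1 + n₀))
    (hcardj : Nat.card {y : (propagatedSelmerStructure W 3 kt).selmerGroup // 3 ^ (kt - k) • y = 0} =
      3 ^ (kt - k + n₀))
    (hcardtop : Nat.card {y : (propagatedSelmerStructure W 3 kt).selmerGroup // 3 ^ kt • y = 0} =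
      3 ^ (kt + n₀))
    -- (iv) the order of the bottom class
    (hord : addOrderOf (g ∅) * 3 ^ n₀ = 3 ^ (k + 1)) :
    ∃ e ∈ (propagatedSelmerStructure W 3 k).selmerGroup,
      ∃ m' ∈ (W.kummerSelmerStructure (((3 : ℕ) : ℤ) ^ k * ((3 : ℕ) : ℤ))).selmerGroup,
        g ∅ = 3 ^ n₀ • e + m' := by
  haveI : Fact (Nat.Prime 3) := ⟨Nat.prime_three⟩
  haveI : Fact (1 < 3 ^ (k + 1)) := ⟨Nat.one_lt_pow (Nat.succ_ne_zero _) (by norm_num)⟩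
  haveI : NeZero (3 ^ (k + 1)) := ⟨pow_ne_zero _ (by norm_num)⟩
  have hsurj : W.HasSurjectiveModNGaloisRep ((3 : ℕ) : ℤ) := by simpa using htower 1
  have hK : Dk.IsKolyvaginSystem (propagatedSelmerStructure W 3 k) g :=
    (KolyvaginDatum.mem_kolyvaginSystems_iff _ _ _).mp hg
  have hKt : Dt.IsKolyvaginSystem (propagatedSelmerStructure W 3 kt) gt :=
    (KolyvaginDatum.mem_kolyvaginSystems_iff _ _ _).mp hgt
  -- (L-c): a core vertex `d₀` with `red_*(g̃ d₀) = w • g d₀`, `3 ∤ w` (landed)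
  obtain ⟨d₀, hd₀, -, hN, w, hw, hcmp⟩ := exists_coreVertex_map_red_eq_smul W hkk Dk Dt red hred hsurj
    hTk hTt hPP inv inv' hg hgt hgto hR22 hR22' hPT hPT'
  have hgo₀ : addOrderOf (g d₀) = 3 ^ (k + 1) := by
    have h := (hR22 d₀ (Set.Subset.trans hd₀ hPP)).1 (by rw [hN]; exact one_dvd _)
    rwa [hN, mul_one] at h
  -- the restricted (deep) datum at level `k`
  let Dr : KolyvaginDatum (W.torsionGaloisModule (((3 : ℕ) : ℤ) ^ k * ((3 : ℕ) : ℤ))) :=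
    { Dk with primes := Dt.primes }
  have hDr : Dr.HasCanonicalComparison (3 ^ (k + 1)) η := KSRestrict.hasCanonicalComparison_restrictPrimes hDk hPP
  have hgr : (fun d : Finset (HeightOneSpectrum (𝓞 ℚ)) =>
        if (↑d : Set (HeightOneSpectrum (𝓞 ℚ))) ⊆ Dt.primes then g d else 0) ∈
      Dr.kolyvaginSystems (propagatedSelmerStructure W 3 k) :=
    KSRestrict.mem_kolyvaginSystems_restrictPrimes hg hPP
  -- (L-a) from the S24-DEEP port: freeness of `KS₁` of the deep datum, rigidity at `d₀`
  obtain ⟨hfree, -⟩ := kolyvaginSystems_freeRankOne_propagatedSelmerStructure_deep_of_towerSurj W hS24d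
    hkk htower τ hτμ hτq inv₃ hperf₃ hsum₃ hcompl₃ hEP S hS h3S hbadS Dr η hPt hTk hDr
  have hinj : ∀ s : Finset (HeightOneSpectrum (𝓞 ℚ)) →
        galoisCohomology (W.torsionGaloisModule (((3 : ℕ) : ℤ) ^ k * ((3 : ℕ) : ℤ))) 1,
      Dr.IsKolyvaginSystem (propagatedSelmerStructure W 3 k) s → s d₀ = 0 → s ∅ = 0 := by
    intro s hs hs0
    have hgo₀' : addOrderOf ((fun d : Finset (HeightOneSpectrum (𝓞 ℚ)) =>
        if (↑d : Set (HeightOneSpectrum (𝓞 ℚ))) ⊆ Dt.primes then g d else 0) d₀) = 3 ^ (k + 1) := by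
      rw [KSRestrict.restrictPrimes_apply_of_subset _ _ hd₀, hgo₀]
    have h := apply_eq_zero_of_free_of_fullOrder hfree hgr hgo₀'
      ((KolyvaginDatum.mem_kolyvaginSystems_iff _ _ _).mpr hs) hs0
    rw [h, Pi.zero_apply]
  -- the liftability road (landed assembly)
  have hPS : ∀ q ∈ Dt.primes, (Sum.inr q : Place ℚ) ∉ S := fun q hq => by
    rw [hPt] at hq
    exact hq.1
  exact stubShape_of_coreVertex_inputs W hsurj hkk red hred hS h3S hbadS hPP (le_of_eq hPt) hPS hTk hTt hDk
    hDt hK hKt hinj hd₀ hw hcmp hcard hcardj hcardtop hord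

end Summit.BirchSwinnertonDyer.BirchSwinnertonDyer.Theorems.KimAtThreeStubOfLiftable

end
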